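import Mathlib
import Literature.Analysis.FluidPDE.Tao2016AveragedNS.ShiftSetCascadeFlows
import Summits.NavierStokesRegularity.NavierStokesRegularity.Theorems.TaoLadderRungTwoFlatCertificateGlueCheckerCoefOn
import Summits.NavierStokesRegularity.NavierStokesRegularity.Theorems.TaoLadderRungTwoFlatCertificateGlueCheckerFieldArrayOn
import HarnessLib

/-!
# Certificate glue on a shift set `𝕊`, XXV-m: TABULATED COEFFICIENT BOXES — the coefficient boxes of the window field read from an ARRAY computed once per
  certificate (`coefLookup`), a Boolean self-check `checkCoefTab` (every table entry CONTAINS the on-the-fly box `coefBoxOf`), and the soundness transfer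
  `coefBoxOK_lookup` (helper for items stmt-NavierStokesRegularity-22987 `FlatGapCertificatesV2` (crux K_A♭ of route TaoLadderRungTwoFlat) and stmt-24295
  K_A₂(64); cell harvest/h2-tao-ladder, p1 g16; TIMING: with `coefBoxOf` evaluated on the fly the order-16 jets of one n = 98 state cost ≈ 270 s, with a table
  ≈ 20 s — the field evaluates each coefficient box ≈ 10⁵ times per step)

The checker theorems are generic in the coefficient-box function `coefB` under `CoefBoxOK`; this file lets an instance pass a table lookup instead of
`coefBoxOf prec αq ωq Sp Sm` without any index arithmetic in the proofs: correctness of the table is itself CHECKED (`IntervalD.subset`, 2·W·m²·|shifts|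
entries, once).

HONEST FRAMING: Tao-type MODEL lattices (Tao 2016 §4/§6 vocabulary, shift-set parametrised); arithmetic plumbing — no certificate data, nothing certified,
no stub closed, nothing about the Navier–Stokes equations.
-/

-- the sub-problem namespace repeats the summit name by design (D-0017)
set_option linter.dupNamespace false

namespace Summit.NavierStokesRegularity.NavierStokesRegularity.Theorems

open Set Finset Literature.Analysis.FluidPDE Literature.Analysis.FluidPDE.TaoCascade
open Summit.NavierStokesRegularity.NavierStokesRegularity.Theorems.TaylorModelCert

namespace CertificateGlueOn

variable {m : ℕ} {Kb Ka : ℤ}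

/-- The flat table index of `(i, k, i₁, i₂, μ)`: `((((i·W + (k+Kb))·m + i₁)·m + i₂)·S + idx(μ))`. [folklore] -/
def coefIdx (m : ℕ) (Kb Ka : ℤ) (shifts : List (ℤ × ℤ × ℤ)) (i : Fin m) (k : ℤ) (i₁ i₂ : Fin m) (μ : ℤ × ℤ × ℤ) : ℕ :=
  (((i.val * winLen Kb Ka + (k + Kb).toNat) * m + i₁.val) * m + i₂.val) * shifts.length + shifts.idxOf μ

/-- **Coefficient boxes from a table** (junk `0`-box beyond the table). [folklore] -/
def coefLookup (m : ℕ) (Kb Ka : ℤ) (shifts : List (ℤ × ℤ × ℤ)) (tab : Array IntervalD)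
    (i : Fin m) (k : ℤ) (i₁ i₂ : Fin m) (μ : ℤ × ℤ × ℤ) : IntervalD :=
  IntervalD.aget tab (coefIdx m Kb Ka shifts i k i₁ i₂ μ)

/-- **The table built from `coefBoxOf`** (decoding the flat index; its correctness is not proved but CHECKED by `checkCoefTab`). [folklore] -/
def coefTabArr (m : ℕ) (Kb Ka : ℤ) (prec : ℕ) (shifts : List (ℤ × ℤ × ℤ)) (αq : Fin m → Fin m → Fin m → ℤ × ℤ × ℤ → ℚ)
    (ωq : Fin m → ℤ → ℚ) (Sp Sm : IntervalD) : Array IntervalD :=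
  let W := winLen Kb Ka
  let S := shifts.length
  Array.ofFn fun t : Fin (m * W * m * m * S) =>
    let μi := t.val % S
    let i₂ := (t.val / S) % m
    let i₁ := (t.val / (S * m)) % m
    let kk := (t.val / (S * m * m)) % W
    let i := (t.val / (S * m * m * W)) % m
    if hm : 0 < m then
      coefBoxOf prec αq ωq Sp Sm ⟨i, Nat.mod_lt _ hm⟩ ((kk : ℤ) - Kb) ⟨i₁, Nat.mod_lt _ hm⟩ ⟨i₂, Nat.mod_lt _ hm⟩ (shifts.getD μi (0, 0, 0))
    else IntervalD.ofInt 0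

/-- **The table self-check**: every entry used on the window CONTAINS the on-the-fly coefficient box. [folklore] -/
def checkCoefTab (m : ℕ) (Kb Ka : ℤ) (prec : ℕ) (shifts : List (ℤ × ℤ × ℤ)) (αq : Fin m → Fin m → Fin m → ℤ × ℤ × ℤ → ℚ)
    (ωq : Fin m → ℤ → ℚ) (Sp Sm : IntervalD) (tab : Array IntervalD) : Bool :=
  (List.finRange m).all fun i => (List.range (winLen Kb Ka)).all fun kk => (List.finRange m).all fun i₁ => (List.finRange m).all fun i₂ =>
    shifts.all fun μ =>
      IntervalD.subset (coefBoxOf prec αq ωq Sp Sm i ((kk : ℤ) - Kb) i₁ i₂ μ) (coefLookup m Kb Ka shifts tab i ((kk : ℤ) - Kb) i₁ i₂ μ)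

/-- **SOUNDNESS TRANSFER**: a table passing the self-check is a sound coefficient-box function (`CoefBoxOK`), by `coefBoxOK_coefBoxOf` and `IntervalD.mem_of_subset`.
[cite: Tao2016AveragedNS, §4 (4.8); cell certificate format, checker field] -/
theorem coefBoxOK_lookup (prec : ℕ) {q : ℚ} (hq : 0 < 1 + (q : ℝ)) (αq : Fin m → Fin m → Fin m → ℤ × ℤ × ℤ → ℚ) (ωq : Fin m → ℤ → ℚ)
    {Sp Sm : IntervalD} (hSp : sqrtCheck prec (1 + q) Sp = true) (hSm : sqrtCheck prec (1 / (1 + q)) Sm = true) (shifts : List (ℤ × ℤ × ℤ))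
    {tab : Array IntervalD} (h : checkCoefTab m Kb Ka prec shifts αq ωq Sp Sm tab = true) :
    CoefBoxOK shifts (q : ℝ) (fun i₁ i₂ i μ => (αq i₁ i₂ i μ : ℝ)) Kb Ka (fun i k => (ωq i k : ℝ)) (coefLookup m Kb Ka shifts tab) := by
  intro i k i₁ i₂ μ hμ hk1 hk2
  have hof := coefBoxOK_coefBoxOf (Kb := Kb) (Ka := Ka) prec hq αq ωq hSp hSm shifts i k i₁ i₂ μ hμ hk1 hk2
  simp only [checkCoefTab, List.all_eq_true, List.mem_finRange, List.mem_range, true_implies] at h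
  have hkk : (k + Kb).toNat < winLen Kb Ka := by unfold winLen; rw [Int.toNat_lt_toNat (by omega)]; omega
  have hsub := h i (k + Kb).toNat hkk i₁ i₂ μ hμ
  rw [Int.toNat_of_nonneg (by omega), show k + Kb - Kb = k by ring] at hsub
  exact IntervalD.mem_of_subset hsub hof

end CertificateGlueOn

end Summit.NavierStokesRegularity.NavierStokesRegularity.Theorems
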